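import Literature.AnabelianGeometry.EtaleTheta.ThetaCoversMonodromyModelLoop
import Literature.AnabelianGeometry.EtaleTheta.ThetaRootOrbitsMonodromyToyOrbit
import HarnessLib

/-!
# [EtTh] §2 Def. 2.7 at the LOOP-CUT monodromy toy: the print-recipe orbit datum
# `MonodromyModel.thetaOrbitDataLoop l hl : ThetaOrbitData (monodromyModelLoop l hl)` (DEF-BEARING, part A′)

S. Mochizuki, *The étale theta function and its Frobenioid-theoretic manifestations* [EtTh], Publ. RIMS **45**
(2009), §1 Prop. 1.3 pp. 19–21 (the étale theta class), §2 Def. 2.5 p. 39, Def. 2.7 p. 41 (the orbit collections and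
«`η̈^Θ` determines `η̲̈^Θ ∈ H¹(Π^tp_{Ÿ̲̲}, l·Δ_Θ)` with `l·η̲̈^Θ = η̈^Θ|`»), Cor. 2.8 p. 42 (PRIMS text pages)
[cite: MochizukiEtTh2009, Def 2.7 p.41].  Cell `abc-iut`, F lane (FACT-LIST rows F-0640 `ThetaOrbitData.Cor28_i`, F-0641
`Cor28_iii`), seat abc-iut-f-128 (gen 14); abc-iut-L2-lead custody (R1504/R1515 rails, count-neutral).  Carrier:
`monodromyModelLoop l hl` (`ThetaCoversMonodromyModelLoop.lean`: abc-iut-w6-d084's monodromy toy with `X̲ → X` cut by the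
LOOP INDEX, Def. 2.5 (i)(a) TRUE); cyclotome, theta class and `Ÿ`-collections = those of part A
(`ThetaRootOrbitsMonodromyToy.lean`: `thetaTop`, `etaFn`, `etaColl`, `etaCollL`, `etaCollLZ`) — they live on `Π^tp_Ÿ`,
which the two carriers share.

WHAT IS NEW: `Π^tp_{Ÿ̲̲} = Π^tp_Ÿ ∩ Π^tp_{X̲̲}` is now the `b`-axis `{(b, 0)} ≅ ℤ/l` (non-trivial), and the toy theta class
restricts TRIVIALLY to it (`c = 0` there).  Its `l`-th roots are ALL the multiplicative `ξ : b ↦ [z^{jb}]`, `j ∈ ℤ/l`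
(`Δ_Θ ≅ ℤ/l` is `l`-torsion, so print's uniqueness of the root — `Δ_Θ ≅ Ẑ(1)` torsion-free — and its
`μ_l`-indeterminacy «up to a root of unity of order `l`» — an inflated `G_K`-twist, trivial at `G_K = 1` — both
DEGENERATE here); the root collections are therefore taken to be the set of ALL roots (`rootCollLoop`: the
singletons of the multiplicative maps `Π^tp_{Ÿ̲̲} → Δ_Θ`), which is what «determined up to `μ_l`» leaves invariant.
`Dtau := {1}` as before (forced by `G_K = 1`).  Sequel (PROOF-ONLY, `ThetaRootOrbitsMonodromyToyLoopCor28i.lean`): the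
typed Cor. 2.8 (i) HOLDS at this datum for EVERY topological `Γ` — all four clauses — and so does Cor. 2.8 (iii).

HONEST LABEL (abc-iut-L2-lead R1352, verbatim, inherited): «a DESIGNED tempered toy with print's monodromy combinatorics —
loop ↦ `Δ̄^ell` (`b`-cycle), the inversion INVERTS it, unipotent monodromy `x ↦ x·z` on the `a`-cycle, `z` = cusp inertia =
`Δ̄_Θ` central; `G_K := 1`; NOT a Tate curve, NOT the tempered fundamental group of a curve; consistency ≠ faithfulness;
nothing here takes a side on anything printed.»  DEGENERATE in the `G_K`/`±1`/`μ_l` directions (said above), GENUINE in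
the `Γ`-quantifier.  DEF-BEARING (class (b): one collection + one `@[reducible]` orbit datum over the new carrier; 0
`instance`, 0 notation; interfaces instantiated, never edited).  Not the natural instance `ofEmbedding` (cover of record:
conditional, (E) parked R1429); a statement about OUR typed predicate at a designed toy, not about [EtTh] in print; no
bearing on [IUTchIII] Cor. 3.12; no side taken; typed ≠ proved.
-/

noncomputable section

namespace Literature.AnabelianGeometry.EtaleTheta.ThetaCovers.MonodromyModel

open Multiplicative HeisenbergWitness TemperedModel DihedralGroup

variable (l : ℕ) [NeZero l] (hl : Odd l)

omit [NeZero l] in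
/-- On `Π^tp_Ÿ = (ℤ/l)²`, `g^n` has coordinates `(n·b, n·c)`; in particular `g^l = 1`. (toy bookkeeping)
[cite: MochizukiEtTh2009, Def 2.5 p.39] -/
theorem pow_coords_of_mem_PiYddT {g : TG l} (hg : g ∈ PiYddT l) (n : ℕ) :
    (g ^ n).1.right = 1 ∧ bC l (g ^ n) = n * bC l g ∧ cC l (g ^ n) = n * cC l g ∧ (g ^ n).2 = 1 := by
  obtain ⟨hd, he⟩ := (mem_PiYddT_iff l g).mp hg
  induction n with
  | zero => exact ⟨rfl, by rw [pow_zero, bC_one, Nat.cast_zero, zero_mul], by rw [pow_zero, cC_one, Nat.cast_zero,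
      zero_mul], rfl⟩
  | succ n ih =>
    have hmem : g ^ n ∈ PiYddT l := (mem_PiYddT_iff l _).mpr ⟨ih.1, ih.2.2.2⟩
    refine ⟨?_, ?_, ?_, ?_⟩
    · rw [pow_succ, right_mul, ih.1, hd, one_mul]
    · rw [pow_succ, bC_mul_of_mem l hmem, ih.2.1, Nat.cast_succ]; ring
    · rw [pow_succ, cC_mul_of_mem l hmem, ih.2.2.1, Nat.cast_succ]; ring
    · rw [pow_succ, snd_mul, ih.2.2.2, he, one_mul]

omit [NeZero l] in
/-- `Π^tp_Ÿ` has exponent `l`: `g^l = 1`. (toy bookkeeping) [cite: MochizukiEtTh2009, Def 2.5 p.39] -/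
theorem pow_l_eq_one_of_mem_PiYddT {g : TG l} (hg : g ∈ PiYddT l) : g ^ l = 1 := by
  have h := pow_coords_of_mem_PiYddT l hg l
  exact TG.ext l h.1 (by rw [h.2.1, ZMod.natCast_self, zero_mul, bC_one])
    (by rw [h.2.2.1, ZMod.natCast_self, zero_mul, cC_one]) h.2.2.2

/-- **The root collection on `Π^tp_{Ÿ̲̲}` = the `b`-axis: ALL multiplicative maps `Π^tp_{Ÿ̲̲} → Δ_Θ`** (the `l` roots
`b ↦ [z^{jb}]` of `η₀|_{Ÿ̲̲} = 1`, as singleton classes). DEGENERATE-by-`G_K = 1` replacement for print's «one root up to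
`μ_l`» (file header). (toy bookkeeping for [EtTh] Def. 2.7 «`η̲̈^{Θ,l·ℤ×μ₂}`»; no claim about print)
[cite: MochizukiEtTh2009, Def 2.7 p.41] -/
def rootCollLoop :
    Set (Set (↥(PiYddT l ⊓ (monodromyModelLoop l hl).tp (monodromyModelLoop l hl).PiXuu) → DTh l)) :=
  {c | ∃ ξ : ↥(PiYddT l ⊓ (monodromyModelLoop l hl).tp (monodromyModelLoop l hl).PiXuu) → DTh l,
    (∀ g h, ξ (g * h) = ξ g * ξ h) ∧ c = {ξ}}

omit [NeZero l] in
/-- A multiplicative map on `Π^tp_{Ÿ̲̲}` sends `1` to `1`. (toy bookkeeping) [cite: MochizukiEtTh2009, Def 2.7 p.41] -/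
theorem map_one_of_mul {G : Type*} [Group G] {ξ : G → DTh l} (hξ : ∀ g h, ξ (g * h) = ξ g * ξ h) : ξ 1 = 1 := by
  have h := hξ 1 1
  rw [one_mul] at h
  exact (mul_left_cancel (a := ξ 1) (by rw [mul_one]; exact h)).symm

omit [NeZero l] in
/-- A multiplicative map commutes with powers. (toy bookkeeping) [cite: MochizukiEtTh2009, Def 2.7 p.41] -/
theorem map_pow_of_mul {G : Type*} [Group G] {ξ : G → DTh l} (hξ : ∀ g h, ξ (g * h) = ξ g * ξ h) (g : G) (n : ℕ) :
    ξ (g ^ n) = ξ g ^ n := by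
  induction n with
  | zero => rw [pow_zero, pow_zero, map_one_of_mul l hξ]
  | succ n ih => rw [pow_succ, hξ, ih, pow_succ]

/-- **«`l · η̲̈^Θ = η̈^Θ|_{Ÿ̲̲}`» at the loop-cut toy**: every multiplicative `ξ` on the `b`-axis satisfies `ξ^l = 1 =
η₀|_{Ÿ̲̲}` (`Π^tp_{Ÿ̲̲}` has exponent `l`; `η₀` is `[z^c]` and `c = 0` on the `b`-axis). (toy bookkeeping for [EtTh] Def. 2.7;
no claim about print) [cite: MochizukiEtTh2009, Def 2.7 p.41] -/
theorem root_pow_loop {ξ : ↥(PiYddT l ⊓ (monodromyModelLoop l hl).tp (monodromyModelLoop l hl).PiXuu) → DTh l}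
    (hξ : ∀ g h, ξ (g * h) = ξ g * ξ h)
    (g : ↥(PiYddT l ⊓ (monodromyModelLoop l hl).tp (monodromyModelLoop l hl).PiXuu)) :
    ξ g ^ l = etaFn l 1 0 ⟨g, g.2.1⟩ := by
  have hg := (mem_PiYddT_inf_tp_PiXuu_loop l hl (g : TG l)).mp g.2
  have hgl : g ^ l = 1 := Subtype.ext (pow_l_eq_one_of_mem_PiYddT l g.2.1)
  rw [← map_pow_of_mul l hξ, hgl, map_one_of_mul l hξ, etaFn_apply]
  show (1 : DTh l) = thetaCoeff l (ofAdd (1 * cC l (g : TG l) + 0 * bC l (g : TG l)))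
  rw [hg.2.2, mul_zero, zero_mul, add_zero, ofAdd_zero, thetaCoeff_one]

/-- **THE PRINT-RECIPE ORBIT DATUM AT THE LOOP-CUT TOY** — `Δ_Θ := ⟨z⟩/1`, `Dtau := {1}`, the three `Ÿ`-collections of
part A (`η̈^{Θ,ℤ×μ₂}` = the 2l translates, `η̈^{Θ,l·ℤ×μ₂} = {η₀^{±1}}`, `η̈^{Θ,l·ℤ} = {η₀}`), roots := ALL `l`-th roots on the
`b`-axis (`rootCollLoop`).  HONEST LABEL: R1352 DESIGNED TOY (header); `@[reducible]` like the carrier.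
[cite: MochizukiEtTh2009, Def 2.7 p.41] -/
@[reducible] def thetaOrbitDataLoop : ThetaOrbitData (monodromyModelLoop l hl) where
  top := thetaTop l
  bot := ⊥
  bot_le := bot_le
  top_normal := thetaTop_normal l
  bot_normal := inferInstance
  top_le := le_inf (thetaTop_le_PiYddT l) fun _ _ => MonoidHom.mem_ker.mpr (Subsingleton.elim _ _)
  Dtau := {⊥}
  Dtau_le := by
    intro D hD
    rw [Set.mem_singleton_iff] at hD
    rw [hD]
    exact bot_le
  Dtau_nonempty := ⟨⊥, rfl⟩
  Dtau_aug := by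
    intro D hD
    rw [Set.mem_singleton_iff] at hD
    subst hD
    refine ⟨?_, ?_⟩
    · rw [Subgroup.coe_bot]
      exact Set.injOn_singleton _ _
    · rw [Subgroup.map_bot]
      infer_instance
  etaZMu2 := etaColl l
  etaLZMu2 := etaCollL l
  etaLZ := etaCollLZ l
  etaLZ_sub := etaColl_sub l
  rootLZMu2 := rootCollLoop l hl
  rootLZ := rootCollLoop l hl
  rootLZ_sub := subset_rfl
  root_pow := by
    rintro c ⟨ξ, hξ, rfl⟩ ξ' hξ'
    rw [Set.mem_singleton_iff] at hξ'
    subst hξ'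
    exact ⟨{etaFn l 1 0}, Or.inl rfl, etaFn l 1 0, rfl, root_pow_loop l hl hξ⟩

/-- The fields of the datum, definitionally. (toy bookkeeping) [cite: MochizukiEtTh2009, Def 2.7 p.41] -/
theorem thetaOrbitDataLoop_fields :
    (thetaOrbitDataLoop l hl).top = thetaTop l ∧ (thetaOrbitDataLoop l hl).bot = ⊥ ∧
      (thetaOrbitDataLoop l hl).Dtau = {⊥} ∧ (thetaOrbitDataLoop l hl).etaZMu2 = etaColl l ∧
      (thetaOrbitDataLoop l hl).etaLZMu2 = etaCollL l ∧ (thetaOrbitDataLoop l hl).etaLZ = etaCollLZ l ∧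
      (thetaOrbitDataLoop l hl).rootLZMu2 = rootCollLoop l hl ∧ (thetaOrbitDataLoop l hl).rootLZ = rootCollLoop l hl ∧
      (thetaOrbitDataLoop l hl).DeltaTheta = DTh l :=
  ⟨rfl, rfl, rfl, rfl, rfl, rfl, rfl, rfl, rfl⟩

end Literature.AnabelianGeometry.EtaleTheta.ThetaCovers.MonodromyModel

end
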